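/-
Copyright (c) 2026. All rights reserved.
Released under Apache 2.0 license as described in the file LICENSE.
Authors: abc-iut cell, wave-4 seat abc-iut-w4-d064 (proof-only; [SemiAnbd] Cor 3.9 step R3, sub-node R3a).
-/
import Literature.AnabelianGeometry.SemiGraphs.TemperedReconstructionR3Sub
import Literature.AnabelianGeometry.SemiGraphs.TemperedReconstructionR3aAssembly
import Literature.AnabelianGeometry.SemiGraphs.TemperedChartGlueElements
import Literature.AnabelianGeometry.SemiGraphs.TemperedVerticialNamedFactsProofs
import Literature.AnabelianGeometry.SemiGraphs.TemperedEdgeLikeProofs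
import Literature.AnabelianGeometry.SemiGraphs.MorphismsOver
import Literature.AnabelianGeometry.SemiGraphs.TemperedMaximalCompact
import HarnessLib

/-!
# [SemiAnbd] Cor 3.9, step R3, sub-node (R3a) `TwistAbsorption` — PROVED

Mochizuki, *Semi-graphs of anabelioids*, Publ. RIMS **42** (2006) [MochizukiSemiAnbd2006], Cor 3.9,
proof p. 43 ll. 9–13 ("is compatible with the φ_α … [again by Theorem 3.7, (iii), (iv)] … by varying
`G'`, `H'`, we conclude that `φ` arises from a morphism of graphs of anabelioids").  This PROOF-ONLY
file (abc-iut cell, wave-4 seat abc-iut-w4-d064, L3-lead ruling α3-2) proves the named sub-node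
**(R3a) `ProfiniteSemiGraph.TwistAbsorption`** of abc-iut-w4-d080's `TemperedReconstructionR3Sub.lean`
UNCONDITIONALLY (`twistAbsorption_holds`): for `F : G → H` locally open and `φ : π₁^temp(G) → π₁^temp(H)`
compatible with `F` on the verticial (`CompatV`) and edge (`CompatE`) homomorphisms, and `H` satisfying
the edge-like centralizer property (R3c) `EdgeLikeCentralizerAt`, there is a family `θ` of conjugating
elements (the 2-cells of [SemiAnbd] Rmk 2.4.2) with `c_H⁻¹ ⋙ F^*_θ ⋙ c_G ≅ B^temp(φ)`.

PROOF.  Fix verticial/edge homomorphisms `ψ_v, ψ_e` (`G`) and `ψ'_w, ψ'_f` (`H`) with their chart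
isomorphisms (Thm 3.7 (i) `verticialInjective_holds`, `edgeLikeSubgroups_nonempty_of`), conjugators
`g_v`, `g_e` from `CompatV`/`CompatE`, and the chart gluing elements `λ_b` (`G`), `λ'_{b'}` (`H`) of
`TemperedChartGlueElements.lean` (`λ ψ_e λ⁻¹ = ψ_v ∘ b_*`, gluing = translation by `λ`).  At a branch
`b : e ⟶ v` of `G` put `t := ψ'_{Fv}(θ⁰_b)` for the printed conjugator `θ⁰_b = F.conjugator b` and
`l := λ'_{F b}`.  For `u ∈ ψ'_{Fe}(F_e(Π_e))` both `g_v⁻¹ φ(λ_b) g_e · u · (…)⁻¹` and `t l · u · (t l)⁻¹`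
equal `ψ'_{Fv}(F_v(b_* a))` (from `CompatV`, `CompatE`, the two gluing relations and the defining
property of `θ⁰_b`), so `m := g_e⁻¹ φ(λ_b)⁻¹ g_v t l` CENTRALISES `ψ'_{Fe}(F_e(Π_e))` (`twist_comm`) —
the image under the edge homomorphism `ψ'_{Fe}` of the OPEN subgroup `F_e(Π_e) ⊆ Π_{Fe}` (local
openness).  By (R3c) `m` lies in the verticial subgroup `(t l)⁻¹ ψ'_{Fv}(Π_{Fv}) (t l)` (which contains
`ψ'_{Fe}(F_e Π_e) = (tl)⁻¹ ψ'_{Fv}(F_v b_* Π_e) (tl)`), i.e. `m = (tl)⁻¹ ψ'_{Fv}(π₀) (tl)` for some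
`π₀ ∈ Π_{Fv}`; then `θ_b := π₀⁻¹ θ⁰_b` is again a conjugator for `F` at `b` (`ψ'_{Fv}` injective) and
satisfies the branch identity `φ(λ_b) g_e = g_v ψ'_{Fv}(θ_b) λ'_{Fb}`, so the assembly lemma
`Hom.nonempty_chartPullbackWith_iso_of_data` (`TemperedReconstructionR3aAssembly.lean`) gives the
isomorphism.  Inputs BY NAME: Thm 3.7 (i) through its landed discharge; (R3c) as the HYPOTHESIS carried
by `TwistAbsorption` (discharged separately, abc-iut-w4-d080's `TemperedReconstructionR3cProofs.lean`,
modulo Thm 3.7 (iii) `CompactInVerticial`).  No definitions; nothing here bears on [IUTchIII] Cor. 3.12.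
-/

namespace Literature.AnabelianGeometry.SemiGraphs

open CategoryTheory Topology
open Literature.AlgebraicGeometry.Frobenioids.QuasiTemperoid.BTempConnected (hom_ρ hom_ext_apply
  ρ_mul_apply)

universe u

namespace ProfiniteSemiGraph

/-- Pure group theory behind the twist absorption at one branch: with `W = g_v⁻¹ φλ (g_e u g_e⁻¹) φλ⁻¹ g_v`
and `W = t (l u l⁻¹) t⁻¹`, the element `m := g_e⁻¹ φλ⁻¹ g_v t l` commutes with `u`.
[cite: MochizukiSemiAnbd2006, Cor 3.9 p.43] -/
theorem twist_comm {Γ : Type u} [Group Γ] {W φl gV gE t l u : Γ}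
    (h1 : W = gV⁻¹ * φl * (gE * u * gE⁻¹) * φl⁻¹ * gV) (h2 : W = t * (l * u * l⁻¹) * t⁻¹) :
    (gE⁻¹ * φl⁻¹ * gV * t * l) * u * (gE⁻¹ * φl⁻¹ * gV * t * l)⁻¹ = u := by
  have E : t * (l * u * l⁻¹) * t⁻¹ = gV⁻¹ * φl * (gE * u * gE⁻¹) * φl⁻¹ * gV := h2.symm.trans h1
  calc (gE⁻¹ * φl⁻¹ * gV * t * l) * u * (gE⁻¹ * φl⁻¹ * gV * t * l)⁻¹
      = gE⁻¹ * φl⁻¹ * gV * (t * (l * u * l⁻¹) * t⁻¹) * gV⁻¹ * φl * gE := by group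
    _ = gE⁻¹ * φl⁻¹ * gV * (gV⁻¹ * φl * (gE * u * gE⁻¹) * φl⁻¹ * gV) * gV⁻¹ * φl * gE := by rw [E]
    _ = u := by group

/-- **(R3a) `TwistAbsorption` — PROVED.** [cite: MochizukiSemiAnbd2006, Cor 3.9 p.43] -/
theorem twistAbsorption_holds :
    Literature.AnabelianGeometry.SemiGraphs.ProfiniteSemiGraph.TwistAbsorption.{u} := by
  intro 𝒢 ℋ h𝒢 hℋ c𝒢 cℋ hR3c F φ hF hV hE
  classical
  have h37 := h𝒢.thm37Hypotheses
  have h37' := hℋ.thm37Hypotheses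
  -- verticial homomorphisms with their chart isomorphisms, for every vertex of `G` and of `H`
  have hexV : ∀ v : 𝒢.graph.Vertex, ∃ ψ : 𝒢.Gv v →ₜ* c𝒢.G,
      Nonempty (c𝒢.equiv.inverse ⋙ ObjectProperty.ι _ ⋙ restrictV 𝒢 v ≅ BTemp.res ψ) := fun v => by
    obtain ⟨_, ψ, hψ, -⟩ := (verticialInjective_holds 𝒢 h37 c𝒢 v).1
    exact ⟨ψ, hψ⟩
  choose ψV hψV using hexV
  have iV := fun v => (hψV v).some
  have hexV' : ∀ w : ℋ.graph.Vertex, ∃ ψ : ℋ.Gv w →ₜ* cℋ.G,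
      Nonempty (cℋ.equiv.inverse ⋙ ObjectProperty.ι _ ⋙ restrictV ℋ w ≅ BTemp.res ψ) := fun w => by
    obtain ⟨_, ψ, hψ, -⟩ := (verticialInjective_holds ℋ h37' cℋ w).1
    exact ⟨ψ, hψ⟩
  choose ψV' hψV' using hexV'
  have iV' := fun w => (hψV' w).some
  -- edge homomorphisms with their chart isomorphisms (every edge has an abutting branch)
  have hexE : ∀ e : 𝒢.graph.Edge, ∃ ψ : 𝒢.Ge e →ₜ* c𝒢.G,
      Nonempty (c𝒢.equiv.inverse ⋙ ObjectProperty.ι _ ⋙ restrictE 𝒢 e ≅ BTemp.res ψ) := fun e => by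
    obtain ⟨w⟩ := h𝒢.hasVertex
    obtain ⟨b, hbe, hs⟩ := SemiGraph.exists_abuts_of_isConnected h𝒢.isConnected w e
    obtain ⟨v, h⟩ := Option.isSome_iff_exists.mp hs
    subst hbe
    obtain ⟨_, ψ, hψ, -⟩ := edgeLikeSubgroups_nonempty_of c𝒢 b v h ⟨ψV v, hψV v⟩
    exact ⟨ψ, hψ⟩
  choose ψE hψE using hexE
  have iE := fun e => (hψE e).some
  have hexE' : ∀ f : ℋ.graph.Edge, ∃ ψ : ℋ.Ge f →ₜ* cℋ.G,
      Nonempty (cℋ.equiv.inverse ⋙ ObjectProperty.ι _ ⋙ restrictE ℋ f ≅ BTemp.res ψ) := fun f => by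
    obtain ⟨w⟩ := hℋ.hasVertex
    obtain ⟨b, hbe, hs⟩ := SemiGraph.exists_abuts_of_isConnected hℋ.isConnected w f
    obtain ⟨v, h⟩ := Option.isSome_iff_exists.mp hs
    subst hbe
    obtain ⟨_, ψ, hψ, -⟩ := edgeLikeSubgroups_nonempty_of cℋ b v h ⟨ψV' v, hψV' v⟩
    exact ⟨ψ, hψ⟩
  choose ψE' hψE' using hexE'
  have iE' := fun f => (hψE' f).some
  -- the compatibility conjugators
  have hexgV : ∀ v, ∃ g : cℋ.G, ∀ π,
      g * ψV' (F.base.vertexMap v) (F.hV v π) * g⁻¹ = φ (ψV v π) := fun v => by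
    obtain ⟨g, hg⟩ := hV v (ψV v) (ψV' (F.base.vertexMap v)) (hψV v) (hψV' _)
    exact ⟨g, fun π => (hg π).symm⟩
  choose gV hgV using hexgV
  have hexgE : ∀ e, ∃ g : cℋ.G, ∀ a,
      g * ψE' (F.base.edgeMap e) (F.hE e a) * g⁻¹ = φ (ψE e a) := fun e => by
    obtain ⟨g, hg⟩ := hE e (ψE e) (ψE' (F.base.edgeMap e)) (hψE e) (hψE' _)
    exact ⟨g, fun a => (hg a).symm⟩
  choose gE hgE using hexgE
  -- the gluing elements of the two charts
  have hexlam : ∀ (b : 𝒢.graph.Branch) (v : 𝒢.graph.Vertex) (h : 𝒢.graph.abuts b = some v),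
      ∃ lam : c𝒢.G, (∀ a, lam * ψE (𝒢.graph.edgeOf b) a * lam⁻¹ = ψV v (𝒢.brHom b v h a)) ∧
        ∀ (Y : BTemp c𝒢.G) (y : Y.obj.V),
          ((iV v).hom.app Y).hom.hom
              (((c𝒢.equiv.inverse.obj Y).obj.glue b v h).hom.hom.hom
                (((iE (𝒢.graph.edgeOf b)).inv.app Y).hom.hom y)) = Y.obj.ρ lam y :=
    fun b v h => c𝒢.exists_glueElement h rfl (iE (𝒢.graph.edgeOf b)) (iV v)
  choose lam hlamc hlam using hexlam
  have hexlam' : ∀ (b : 𝒢.graph.Branch) (v : 𝒢.graph.Vertex) (h : 𝒢.graph.abuts b = some v),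
      ∃ lam' : cℋ.G,
        (∀ a', lam' * ψE' (F.base.edgeMap (𝒢.graph.edgeOf b)) a' * lam'⁻¹ =
          ψV' (F.base.vertexMap v) (ℋ.brHomAt (F.base.branchMap b) (F.base.vertexMap v)
            (F.base.abuts_branchMap b v h) (F.base.edgeMap (𝒢.graph.edgeOf b))
            (F.base.edgeOf_branchMap b) a')) ∧
        ∀ (X : BTemp cℋ.G) (x : X.obj.V),
          ((iV' (F.base.vertexMap v)).hom.app X).hom.hom
              (((cℋ.equiv.inverse.obj X).obj.glue (F.base.branchMap b) (F.base.vertexMap v)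
                  (F.base.abuts_branchMap b v h)).hom.hom.hom
                (F.base.edgeOf_branchMap b ▸
                  ((iE' (F.base.edgeMap (𝒢.graph.edgeOf b))).inv.app X).hom.hom x)) =
            X.obj.ρ lam' x :=
    fun b v h => cℋ.exists_glueElement (F.base.abuts_branchMap b v h) (F.base.edgeOf_branchMap b)
      (iE' (F.base.edgeMap (𝒢.graph.edgeOf b))) (iV' (F.base.vertexMap v))
  choose lam' hlam'c hlam' using hexlam'
  -- injectivity of the verticial homomorphisms of `H`
  have hinjV' : ∀ w, Function.Injective (ψV' w) := fun w =>
    (verticialInjective_holds ℋ h37' cℋ w).2 (ψV' w) (hψV' w)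
  -- the two expressions of `ψ'(F_v(b_* a))`: through `φ` (CompatV, λ_b, CompatE) and through the
  -- chosen conjugating element `θ⁰_b` and `λ'_{F b}`
  have hW : ∀ (b : 𝒢.graph.Branch) (v : 𝒢.graph.Vertex) (h : 𝒢.graph.abuts b = some v)
      (a : 𝒢.Ge (𝒢.graph.edgeOf b)),
      ψV' (F.base.vertexMap v) (F.hV v (𝒢.brHom b v h a)) =
          (gV v)⁻¹ * φ (lam b v h) * (gE (𝒢.graph.edgeOf b) *
            ψE' (F.base.edgeMap (𝒢.graph.edgeOf b)) (F.hE (𝒢.graph.edgeOf b) a) *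
            (gE (𝒢.graph.edgeOf b))⁻¹) * (φ (lam b v h))⁻¹ * gV v ∧
        ψV' (F.base.vertexMap v) (F.hV v (𝒢.brHom b v h a)) =
          ψV' (F.base.vertexMap v) (F.conjugator b v h) *
            (lam' b v h * ψE' (F.base.edgeMap (𝒢.graph.edgeOf b)) (F.hE (𝒢.graph.edgeOf b) a) *
              (lam' b v h)⁻¹) * (ψV' (F.base.vertexMap v) (F.conjugator b v h))⁻¹ := by
    intro b v h a
    constructor
    · have h1 := hgV v (𝒢.brHom b v h a)
      rw [← hlamc b v h a, map_mul, map_mul, map_inv, ← hgE (𝒢.graph.edgeOf b) a] at h1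
      calc ψV' _ (F.hV v (𝒢.brHom b v h a))
          = (gV v)⁻¹ * (gV v * ψV' _ (F.hV v (𝒢.brHom b v h a)) * (gV v)⁻¹) * gV v := by group
        _ = (gV v)⁻¹ * (φ (lam b v h) * (gE _ * ψE' _ (F.hE _ a) * (gE _)⁻¹) *
              (φ (lam b v h))⁻¹) * gV v := by rw [h1]
        _ = _ := by group
    · have h3 := congrArg (ψV' (F.base.vertexMap v)) (F.conjugator_spec b v h a)
      rw [map_mul, map_mul, map_inv] at h3
      change ψV' _ (F.conjugator b v h) * ψV' _ (ℋ.brHomAt (F.base.branchMap b) (F.base.vertexMap v)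
          (F.base.abuts_branchMap b v h) (F.base.edgeMap (𝒢.graph.edgeOf b))
          (F.base.edgeOf_branchMap b) (F.hE _ a)) * (ψV' _ (F.conjugator b v h))⁻¹ =
        ψV' _ (F.hV v (𝒢.brHom b v h a)) at h3
      rw [← hlam'c b v h (F.hE _ a)] at h3
      exact h3.symm
  -- `ψ'(brComp_b x) = λ' ψE'(F_e x) λ'⁻¹`
  have hbr : ∀ (b : 𝒢.graph.Branch) (v : 𝒢.graph.Vertex) (h : 𝒢.graph.abuts b = some v)
      (x : 𝒢.Ge (𝒢.graph.edgeOf b)),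
      ψV' (F.base.vertexMap v) (F.brComp b v h x) =
        lam' b v h * ψE' (F.base.edgeMap (𝒢.graph.edgeOf b)) (F.hE (𝒢.graph.edgeOf b) x) *
          (lam' b v h)⁻¹ := fun b v h x => (hlam'c b v h (F.hE _ x)).symm
  -- THE TWIST: at every branch, `T_b := ψ'(θ⁰_b) λ'_b g_e⁻¹ φ(λ_b)⁻¹ g_v` lies in `ψ'(Π_{F v})`
  have hexπ : ∀ (b : 𝒢.graph.Branch) (v : 𝒢.graph.Vertex) (h : 𝒢.graph.abuts b = some v),
      ∃ π₀ : ℋ.Gv (F.base.vertexMap v),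
        ψV' (F.base.vertexMap v) π₀ =
          ψV' (F.base.vertexMap v) (F.conjugator b v h) * lam' b v h *
            (gE (𝒢.graph.edgeOf b))⁻¹ * (φ (lam b v h))⁻¹ * gV v := by
    intro b v h
    -- `m := g_e⁻¹ φ(λ)⁻¹ g_v ψ'(θ⁰) λ'` centralises `ψE'(F_e(Π_e))`
    have hm_central : (gE (𝒢.graph.edgeOf b))⁻¹ * (φ (lam b v h))⁻¹ * gV v *
        ψV' (F.base.vertexMap v) (F.conjugator b v h) * lam' b v h ∈ Subgroup.centralizer
        ((((F.hE (𝒢.graph.edgeOf b)).toMonoidHom.range).map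
          (ψE' (F.base.edgeMap (𝒢.graph.edgeOf b))).toMonoidHom : Subgroup cℋ.G) : Set cℋ.G) := by
      rw [Subgroup.mem_centralizer_iff]
      rintro _ ⟨_, ⟨a, rfl⟩, rfl⟩
      change ψE' _ (F.hE _ a) * _ = _ * ψE' _ (F.hE _ a)
      obtain ⟨h1, h2⟩ := hW b v h a
      have key := twist_comm h1 h2
      nth_rewrite 1 [← key]
      group
    -- the verticial subgroup `cc · ψ'(Π_{F v}) · cc⁻¹`, `cc := λ'⁻¹ ψ'(θ⁰)⁻¹`, contains `ψE'(F_e(Π_e))`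
    have hHvert : ((ψV' (F.base.vertexMap v)).toMonoidHom.range).map
        (MulAut.conj ((lam' b v h)⁻¹ * (ψV' (F.base.vertexMap v) (F.conjugator b v h))⁻¹)).toMonoidHom ∈
        verticialSubgroups cℋ (F.base.vertexMap v) :=
      conj_mem_verticialSubgroups cℋ ⟨ψV' _, hψV' _, rfl⟩ _
    have hUH : (((F.hE (𝒢.graph.edgeOf b)).toMonoidHom.range).map
        (ψE' (F.base.edgeMap (𝒢.graph.edgeOf b))).toMonoidHom) ≤
        ((ψV' (F.base.vertexMap v)).toMonoidHom.range).map
          (MulAut.conj ((lam' b v h)⁻¹ * (ψV' (F.base.vertexMap v) (F.conjugator b v h))⁻¹)).toMonoidHom := by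
      rintro _ ⟨_, ⟨a, rfl⟩, rfl⟩
      refine ⟨ψV' _ (F.hV v (𝒢.brHom b v h a)), ⟨_, rfl⟩, ?_⟩
      change (lam' b v h)⁻¹ * (ψV' _ (F.conjugator b v h))⁻¹ * ψV' _ (F.hV v (𝒢.brHom b v h a)) *
        ((lam' b v h)⁻¹ * (ψV' _ (F.conjugator b v h))⁻¹)⁻¹ = ψE' _ (F.hE _ a)
      rw [(hW b v h a).2]
      group
    -- (R3c) at `H`: the centraliser lies in that verticial subgroup
    have hm := hR3c (F.base.edgeMap (𝒢.graph.edgeOf b)) (ψE' _) (hψE' _)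
      (F.hE (𝒢.graph.edgeOf b)).toMonoidHom.range (hF.2 _) (F.base.vertexMap v) _ hHvert hUH hm_central
    obtain ⟨_, ⟨π₀, rfl⟩, hπ⟩ := hm
    refine ⟨π₀, ?_⟩
    change (lam' b v h)⁻¹ * (ψV' _ (F.conjugator b v h))⁻¹ * ψV' _ π₀ *
      ((lam' b v h)⁻¹ * (ψV' _ (F.conjugator b v h))⁻¹)⁻¹ = _ at hπ
    calc ψV' _ π₀
        = (ψV' _ (F.conjugator b v h) * lam' b v h) *
            ((lam' b v h)⁻¹ * (ψV' _ (F.conjugator b v h))⁻¹ * ψV' _ π₀ *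
              ((lam' b v h)⁻¹ * (ψV' _ (F.conjugator b v h))⁻¹)⁻¹) *
            ((lam' b v h)⁻¹ * (ψV' _ (F.conjugator b v h))⁻¹) := by group
      _ = (ψV' _ (F.conjugator b v h) * lam' b v h) *
            ((gE (𝒢.graph.edgeOf b))⁻¹ * (φ (lam b v h))⁻¹ * gV v *
              ψV' (F.base.vertexMap v) (F.conjugator b v h) * lam' b v h) *
            ((lam' b v h)⁻¹ * (ψV' _ (F.conjugator b v h))⁻¹) := by rw [hπ]
      _ = _ := by group
  choose π₀ hπ₀ using hexπ
  -- the absorbing family of conjugating elements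
  let θ : F.ConjugatorFamily :=
    { θ := fun b v h => (π₀ b v h)⁻¹ * F.conjugator b v h
      spec := by
        intro b v h x
        apply hinjV' (F.base.vertexMap v)
        change ψV' _ ((π₀ b v h)⁻¹ * F.conjugator b v h * F.brComp b v h x *
            ((π₀ b v h)⁻¹ * F.conjugator b v h)⁻¹) = ψV' _ (F.hV v (𝒢.brHom b v h x))
        simp only [map_mul, map_inv, hπ₀, hbr, (hW b v h x).1]
        group }
  -- assembly
  refine ⟨θ, ?_⟩
  refine F.nonempty_chartPullbackWith_iso_of_data θ c𝒢 cℋ φ ψV iV ψE iE ψV' iV' ψE' iE' gV hgV gE hgE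
    lam hlam lam' hlam' ?_
  intro b v h
  change φ (lam b v h) * gE (𝒢.graph.edgeOf b) =
    gV v * ψV' (F.base.vertexMap v) ((π₀ b v h)⁻¹ * F.conjugator b v h) * lam' b v h
  rw [map_mul, map_inv, hπ₀]
  group

end ProfiniteSemiGraph

end Literature.AnabelianGeometry.SemiGraphs
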